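import Summits.MatrixMultiplication.MatrixMultiplication.Theorems.AbelianSTPPCensusTAStatFDefs

/-!
# T_A static certificate, range `6780 … 6833` (t*-indexed linear checker with the k-member tree at `τ = 2371/1000`): kernel evaluation, the shape checks of the tree-heavy volumes `3780`, `3808` on single orders / order sub-ranges (one theorem per (volume, sub-range): bounded kernel memory)

Cell mm-stpp (rung F-M1), tier T_A = «beat `2.371`, the record exponent (ADVXXZ'25 / DEK+26 rounded)»; checker in `AbelianSTPPCensusTAStatFDefs.lean`, table and bucket lists in `AbelianSTPPCensusTAStatFData.lean`
(pattern: theory g12's `AbelianSTPPCensusTAStatDDom*/DCk*.lean`).  `decide` with kernel reduction (standard axioms; no `native_decide`), `Elab.async false`;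
consumed by `TAStatF.checkV_sound` / `TAStatF.domV_sound` / `TAStatF.m2V_sound` in the leaf `AbelianSTPPCensusLeafTA6833Closed.lean`.
WHAT THIS IS NOT: arithmetic on shape lists only; no statement about STPP families or `ω`.
-/

set_option linter.dupNamespace false
set_option autoImplicit false
set_option Elab.async false

namespace Summit.MatrixMultiplication.MatrixMultiplication.Theorems.TAStatF

set_option maxHeartbeats 0 in
/-- Heavy volume `3780` (91 shapes; 7126 tree nodes over all orders), orders `6780 … 6806`: every sorted candidate shape passes `checkShape 6780 6806`. [original] -/
theorem ck3780r0 : TAStatF.checkV 6780 6806 1 3780 = true := by decide +kernel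

set_option maxHeartbeats 0 in
/-- Heavy volume `3780` (91 shapes; 7126 tree nodes over all orders), orders `6807 … 6833`: every sorted candidate shape passes `checkShape 6807 6833`. [original] -/
theorem ck3780r1 : TAStatF.checkV 6807 6833 1 3780 = true := by decide +kernel

set_option maxHeartbeats 0 in
/-- Heavy volume `3808` (32 shapes; 10906 tree nodes over all orders), orders `6780 … 6806`: every sorted candidate shape passes `checkShape 6780 6806`. [original] -/
theorem ck3808r0 : TAStatF.checkV 6780 6806 1 3808 = true := by decide +kernel

set_option maxHeartbeats 0 in
/-- Heavy volume `3808` (32 shapes; 10906 tree nodes over all orders), orders `6807 … 6833`: every sorted candidate shape passes `checkShape 6807 6833`. [original] -/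
theorem ck3808r1 : TAStatF.checkV 6807 6833 1 3808 = true := by decide +kernel

end Summit.MatrixMultiplication.MatrixMultiplication.Theorems.TAStatF
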